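import Mathlib
import Summits.KontsevichZagierPeriods.Zeta5Search.CatalanRemarksTGrowth
import Summits.KontsevichZagierPeriods.Zeta5Search.Zudilin2003ExactDecay
import HarnessLib

/-!
# Zudilin's "remarks" note, Theorem 2 — the Casoratian of `(ũ_n, ṽ_n)`, the limit of `ṽ_n/ũ_n`, exact decay

Sequel of `CatalanRemarksTGrowth.lean` (`ũ_n^{1/n} → ((1+√5)/2)⁵` PROVED) for the second Apéry-like
recursion (13) of [Zudilin2002CatalanRemarks, Sect. 2, Theorem 2] (`Literature.…Zudilin2003.{uT, vT, formT,
remarksTheorem2}`), by the tree's sign-free `TailSqueeze` exactly as `Zudilin2003ExactDecay.lean` does it for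
the 2003 recursion — with the one difference that `ũ₀ = 0`, so every bracket starts at `n = 1`:

* `casWT_eq` — Abel: `W̃_n = ũ_nṽ_{n+1} − ũ_{n+1}ṽ_n = 6 · ∏_{i<n} t̃_i`, hence `W̃_n ≠ 0` (`t̃₀ = 43/9`,
  `0 < −t̃_m ≤ 1` for `m ≥ 1`); `log|W̃_n|/n → 0`;
* `contractionT_le` — `|t̃_n| ũ_n/ũ_{n+2} ≤ 1/50` for `n ≥ 1`, so the steps `r̃_{n+1} − r̃_n`
  (`r̃_n = ṽ_n/ũ_n`) shrink geometrically and `r̃_n` converges (`exists_limitT`);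
* for THE LIMIT `L` of `ṽ_n/ũ_n`, unconditionally: `formT_ne_zero_of_tendsto` — `ũ_nL − ṽ_n ≠ 0` for EVERY
  `n`; `tendsto_log_abs_formT_div_of_tendsto` — `log|ũ_nL − ṽ_n|/n → −log ((1+√5)/2)⁵`;
  `tendsto_root_abs_formT_of_tendsto` — `|ũ_nL − ṽ_n|^{1/n} → ((√5−1)/2)⁵`;
* `remarksTheorem2_decay_of_tendsto` — granted only the identification `ṽ_n/ũ_n → G`, the decay conjunct
  (ii) of `remarksTheorem2` (`|ũ_nG − ṽ_n|^{1/n} → ((√5−1)/2)⁵`) holds, and `ũ_nG − ṽ_n ≠ 0` for all `n`.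
  (The identification itself is the business of the sequel.)

HONEST FRAMING: systematic search; no irrationality claim unless certified.  Nothing here bears on the
irrationality of Catalan's constant.
-/

open Filter Topology Finset
open Literature.NumberTheory.Irrationality.Zudilin2003
open Literature.NumberTheory.Transcendental (catalanConstant)
open Literature.Analysis.Asymptotics.PoincareRecurrence
open Summit.KontsevichZagierPeriods.Zeta5Search.Zudilin2003Growth (two_lt_sqrt_five golden_conj_fifth)

namespace Summit.KontsevichZagierPeriods.Zeta5Search.CatalanRemarksVT

/-! ### The Casoratian and the steps of the approximants -/

/-- The Casoratian `W̃_n = ũ_nṽ_{n+1} − ũ_{n+1}ṽ_n` (real). [cite: Zudilin2002CatalanRemarks, Sect. 2, Theorem 2] -/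
noncomputable def casWT (n : ℕ) : ℝ := uTR n * vTR (n + 1) - uTR (n + 1) * vTR n

/-- The approximants `r̃_n = ṽ_n/ũ_n` (meaningful for `n ≥ 1`; `ũ₀ = 0`). [cite: Zudilin2002CatalanRemarks, Sect. 2, Theorem 2] -/
noncomputable def approxT (n : ℕ) : ℝ := vTR n / uTR n

/-- Abel, one step: `W̃_{n+1} = t̃_n W̃_n`. [cite: Zudilin2002CatalanRemarks, Sect. 2, eq. (13)] -/
theorem casWT_succ (n : ℕ) : casWT (n + 1) = tT13 n * casWT n := by
  unfold casWT
  rw [show n + 1 + 1 = n + 2 by ring]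
  exact casoratian_succ uTR vTR sT13 tT13 n (uTR_rec n) (vTR_rec n)

/-- `W̃₀ = ũ₀ṽ₁ − ũ₁ṽ₀ = 0·5 − 6·(−1) = 6`. [cite: Zudilin2002CatalanRemarks, Sect. 2, Theorem 2] -/
theorem casWT_zero : casWT 0 = 6 := by
  unfold casWT uTR vTR uT vT
  rw [solT_zero, solT_one, solT_zero, solT_one]
  norm_num

/-- Abel's formula: `W̃_n = (∏_{i<n} t̃_i) · 6`. [cite: Zudilin2002CatalanRemarks, Sect. 2, eq. (13)] -/
theorem casWT_eq (n : ℕ) : casWT n = (∏ i ∈ range n, tT13 i) * 6 := by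
  induction n with
  | zero => rw [casWT_zero]; simp
  | succ n ih => rw [casWT_succ, ih, prod_range_succ]; ring

/-- `L̃_m − (numerator of −t̃_m) = (2m+2)²(2m+3)(40m+52)`, so `|t̃_m| ≤ 1` for `m ≥ 1`.
[cite: Zudilin2002CatalanRemarks, Sect. 2, eq. (13)] -/
theorem lead13_sub_num13 (m : ℕ) :
    lead13 m - num13 m = (2 * (m : ℝ) + 2) ^ 2 * (2 * (m : ℝ) + 3) * (40 * (m : ℝ) + 52) := by
  unfold lead13 num13; ring

/-- The numerator of `−t̃_m` is positive for `m ≥ 1`. [cite: Zudilin2002CatalanRemarks, Sect. 2, eq. (13)] -/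
theorem num13_pos (m : ℕ) (hm : 1 ≤ m) : 0 < num13 m := by
  have h1 : (1 : ℝ) ≤ m := by exact_mod_cast hm
  unfold num13
  exact mul_pos (mul_pos (by positivity) (by linarith)) (by positivity)

/-- `t̃_m ≠ 0` for every `m` (`t̃₀ = 516/108 = 43/9`). [cite: Zudilin2002CatalanRemarks, Sect. 2, eq. (13)] -/
theorem tT13_ne_zero (m : ℕ) : tT13 m ≠ 0 := by
  rcases Nat.eq_zero_or_pos m with rfl | hm
  · unfold tT13 num13 lead13; norm_num
  · unfold tT13
    exact div_ne_zero (neg_ne_zero.2 (num13_pos m hm).ne') (lead13_pos m).ne'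

/-- `|t̃_m| ≤ 1` for `m ≥ 1`. [cite: Zudilin2002CatalanRemarks, Sect. 2, eq. (13)] -/
theorem abs_tT13_le_one (m : ℕ) (hm : 1 ≤ m) : |tT13 m| ≤ 1 := by
  have hL := lead13_pos m
  have hN := num13_nonneg m hm
  have hd : 0 ≤ lead13 m - num13 m := by rw [lead13_sub_num13]; positivity
  unfold tT13
  rw [neg_div, abs_neg, abs_div, abs_of_nonneg hN, abs_of_pos hL, div_le_one hL]
  linarith

/-- `W̃_n ≠ 0`. [cite: Zudilin2002CatalanRemarks, Sect. 2, Theorem 2] -/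
theorem casWT_ne_zero (n : ℕ) : casWT n ≠ 0 := by
  rw [casWT_eq]
  exact mul_ne_zero (prod_ne_zero_iff.2 fun i _ => tT13_ne_zero i) (by norm_num)

/-- `r̃_{n+1} − r̃_n = W̃_n/(ũ_nũ_{n+1})` (`n ≥ 1`). [cite: Zudilin2002CatalanRemarks, Sect. 2, Theorem 2] -/
theorem approxT_sub (n : ℕ) (hn : 1 ≤ n) :
    approxT (n + 1) - approxT n = casWT n / (uTR n * uTR (n + 1)) := by
  have h0 := (uTR_pos n hn).ne'
  have h1 := (uTR_pos (n + 1) (by omega)).ne'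
  unfold approxT casWT
  rw [div_sub_div _ _ h1 h0, mul_comm (uTR (n + 1)) (uTR n)]
  ring

/-- The steps never vanish (`n ≥ 1`). [cite: Zudilin2002CatalanRemarks, Sect. 2, Theorem 2] -/
theorem approxT_succ_ne (n : ℕ) (hn : 1 ≤ n) : approxT (n + 1) ≠ approxT n := by
  intro h
  have h2 := approxT_sub n hn
  rw [h, sub_self] at h2
  exact div_ne_zero (casWT_ne_zero n) (mul_pos (uTR_pos n hn) (uTR_pos (n + 1) (by omega))).ne' h2.symm

/-- `r̃_{n+2} − r̃_{n+1} = (r̃_{n+1} − r̃_n) · t̃_nũ_n/ũ_{n+2}` (`n ≥ 1`). [cite: Zudilin2002CatalanRemarks, Sect. 2, Theorem 2] -/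
theorem approxT_sub_succ (n : ℕ) (hn : 1 ≤ n) :
    approxT (n + 2) - approxT (n + 1) = (approxT (n + 1) - approxT n) * (tT13 n * uTR n / uTR (n + 2)) := by
  have h0 := (uTR_pos n hn).ne'
  have h1 := (uTR_pos (n + 1) (by omega)).ne'
  have h2 := (uTR_pos (n + 2) (by omega)).ne'
  rw [show n + 2 = n + 1 + 1 by ring, approxT_sub (n + 1) (by omega), approxT_sub n hn, casWT_succ n,
    show n + 1 + 1 = n + 2 by ring]
  field_simp

/-- **The contraction factor**: `|t̃_n| ũ_n/ũ_{n+2} ≤ 1/50` for `n ≥ 1` (`|t̃_n| ≤ 1`, `ũ_{n+2} ≥ (19/2)² ũ_n`).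
[cite: Zudilin2002CatalanRemarks, Sect. 2, Theorem 2] -/
theorem contractionT_le (n : ℕ) (hn : 1 ≤ n) : |tT13 n| * uTR n / uTR (n + 2) ≤ 1 / 50 := by
  have hu2 := uTR_pos (n + 2) (by omega)
  rw [div_le_iff₀ hu2]
  have ht := abs_tT13_le_one n hn
  have hu0 := uTR_pos n hn
  have hg1 := (ratio_bounds_uT n hn).2.1
  have hg2 := (ratio_bounds_uT (n + 1) (by omega)).2.1
  rw [show n + 1 + 1 = n + 2 by ring] at hg2
  have hu2' : (19 / 2 : ℝ) ^ 2 * uTR n ≤ uTR (n + 2) := by nlinarith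
  have : |tT13 n| * uTR n ≤ uTR n := by nlinarith [abs_nonneg (tT13 n)]
  nlinarith

/-- **Geometric shrinking of the steps**: `|r̃_{k+2} − r̃_{k+1}| ≤ (1/50)|r̃_{k+1} − r̃_k|` for `k ≥ 1`.
[cite: Zudilin2002CatalanRemarks, Sect. 2, Theorem 2] -/
theorem abs_approxT_sub_succ_le (k : ℕ) (hk : 1 ≤ k) :
    |approxT (k + 2) - approxT (k + 1)| ≤ 1 / 50 * |approxT (k + 1) - approxT k| := by
  rw [approxT_sub_succ k hk, abs_mul, mul_comm]
  refine mul_le_mul_of_nonneg_right ?_ (abs_nonneg _)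
  rw [abs_div, abs_mul, abs_of_pos (uTR_pos k hk), abs_of_pos (uTR_pos (k + 2) (by omega))]
  exact contractionT_le k hk

/-- **The approximants converge**: `ṽ_n/ũ_n → L` for some real `L`. [cite: Zudilin2002CatalanRemarks, Sect. 2, Theorem 2] -/
theorem exists_limitT : ∃ L : ℝ, Tendsto approxT atTop (𝓝 L) := by
  set f : ℕ → ℝ := fun j => approxT (1 + j) with hf
  have hstep : ∀ j, dist (f j) (f (j + 1)) ≤ |approxT (1 + 1) - approxT 1| * (1 / 50 : ℝ) ^ j := by
    intro j
    have h := TailSqueeze.abs_step_add_le approxT 1 (θ := 1 / 50) (by norm_num) abs_approxT_sub_succ_le 1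
      le_rfl j
    rw [dist_comm, Real.dist_eq, hf]
    simp only
    rw [show 1 + (j + 1) = 1 + j + 1 by ring, mul_comm]
    exact h
  have hcauchy := cauchySeq_of_le_geometric _ _ (by norm_num : (1 / 50 : ℝ) < 1) hstep
  obtain ⟨L, hL⟩ := cauchySeq_tendsto_of_complete hcauchy
  refine ⟨L, ?_⟩
  have h2 : Tendsto (fun j : ℕ => approxT (j + 1)) atTop (𝓝 L) :=
    hL.congr fun j => by simp only [hf, add_comm]
  exact (tendsto_add_atTop_iff_nat 1).1 h2

/-! ### Exact rates of the Casoratian and of the steps -/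

/-- `log|W̃_n|/n → 0` (`W̃_{n+1}/W̃_n = t̃_n → −1`, Elaydi's Lemma 7.14). [cite: Zudilin2002CatalanRemarks, Sect. 2, Theorem 2] -/
theorem tendsto_log_abs_casWT_div : Tendsto (fun n : ℕ => Real.log |casWT n| / n) atTop (𝓝 0) := by
  have h := tendsto_log_abs_div_of_tendsto_ratio casWT 0 (fun n _ => casWT_ne_zero n)
    (show (-1 : ℝ) ≠ 0 by norm_num) (tendsto_tT13.congr fun n => by
      rw [casWT_succ, mul_div_cancel_right₀ _ (casWT_ne_zero n)])
  simpa using h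

/-- `log ũ_{n+1} / n → log ((1+√5)/2)⁵`. [cite: Zudilin2002CatalanRemarks, Sect. 2, Theorem 2] -/
theorem tendsto_log_uT_succ_div :
    Tendsto (fun n : ℕ => Real.log (uTR (n + 1)) / n) atTop
      (𝓝 (Real.log (((1 + Real.sqrt 5) / 2) ^ 5))) := by
  have hl0 : (0 : ℝ) < ((1 + Real.sqrt 5) / 2) ^ 5 := by
    have := two_lt_sqrt_five; positivity
  have h1 : Tendsto (fun n : ℕ => Real.log (uTR (n + 1) / uTR n)) atTop
      (𝓝 (Real.log (((1 + Real.sqrt 5) / 2) ^ 5))) := tendsto_ratio_uT.log hl0.ne'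
  have h2 : Tendsto (fun n : ℕ => Real.log (uTR (n + 1) / uTR n) / n) atTop (𝓝 0) :=
    h1.div_atTop tendsto_natCast_atTop_atTop
  have h3 := tendsto_log_uT_div.add h2
  rw [add_zero] at h3
  refine h3.congr' ?_
  filter_upwards [eventually_ge_atTop 1] with n hn
  have hu0 := uTR_pos n hn
  have hu1 := uTR_pos (n + 1) (by omega)
  show Real.log ((uT n : ℚ) : ℝ) / n + Real.log (uTR (n + 1) / uTR n) / n = Real.log (uTR (n + 1)) / n
  rw [← add_div, Real.log_div hu1.ne' hu0.ne']
  unfold uTR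
  ring

/-- **Exact rate of the steps**: `log|r̃_{n+1} − r̃_n|/n → −2 log ((1+√5)/2)⁵`. [cite: Zudilin2002CatalanRemarks, Sect. 2, Theorem 2] -/
theorem tendsto_log_abs_approxT_sub_div :
    Tendsto (fun n : ℕ => Real.log |approxT (n + 1) - approxT n| / n) atTop
      (𝓝 (-2 * Real.log (((1 + Real.sqrt 5) / 2) ^ 5))) := by
  have h := (tendsto_log_abs_casWT_div.sub tendsto_log_uT_div).sub tendsto_log_uT_succ_div
  have e : (0 : ℝ) - Real.log (((1 + Real.sqrt 5) / 2) ^ 5) - Real.log (((1 + Real.sqrt 5) / 2) ^ 5) =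
      -2 * Real.log (((1 + Real.sqrt 5) / 2) ^ 5) := by ring
  rw [e] at h
  refine h.congr' ?_
  filter_upwards [eventually_ge_atTop 1] with n hn
  have hu0 := uTR_pos n hn
  have hu1 := uTR_pos (n + 1) (by omega)
  have hW := abs_pos.2 (casWT_ne_zero n)
  show Real.log |casWT n| / n - Real.log ((uT n : ℚ) : ℝ) / n - Real.log (uTR (n + 1)) / n =
    Real.log |approxT (n + 1) - approxT n| / n
  rw [approxT_sub n hn, abs_div, abs_mul, abs_of_pos hu0, abs_of_pos hu1,
    Real.log_div hW.ne' (mul_pos hu0 hu1).ne', Real.log_mul hu0.ne' hu1.ne']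
  unfold uTR
  ring

/-! ### The limit `L` of `ṽ_n/ũ_n`: non-vanishing and exact decay of `ũ_nL − ṽ_n` -/

variable {L : ℝ}

/-- **Non-vanishing**: if `ṽ_n/ũ_n → L` then `ũ_nL − ṽ_n ≠ 0` for EVERY `n` (`n = 0`: it is `1`).
[cite: Zudilin2002CatalanRemarks, Sect. 2, Theorem 2] -/
theorem formT_ne_zero_of_tendsto (hL : Tendsto approxT atTop (𝓝 L)) (n : ℕ) :
    uTR n * L - vTR n ≠ 0 := by
  rcases Nat.eq_zero_or_pos n with rfl | hn
  · unfold uTR vTR uT vT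
    rw [solT_zero, solT_zero]
    norm_num
  · have h := TailSqueeze.lim_sub_ne_zero approxT 1 (θ := 1 / 50) (by norm_num) (by norm_num) hL
      abs_approxT_sub_succ_le n hn (approxT_succ_ne n hn)
    have hu := (uTR_pos n hn).ne'
    unfold approxT at h
    intro h0
    apply h
    field_simp
    linarith

/-- **Exact approximation rate**: if `ṽ_n/ũ_n → L` then `log|L − ṽ_n/ũ_n|/n → −2 log ((1+√5)/2)⁵`.
[cite: Zudilin2002CatalanRemarks, Sect. 2, Theorem 2] -/
theorem tendsto_log_abs_subT_div_of_tendsto (hL : Tendsto approxT atTop (𝓝 L)) :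
    Tendsto (fun n : ℕ => Real.log |L - approxT n| / n) atTop
      (𝓝 (-2 * Real.log (((1 + Real.sqrt 5) / 2) ^ 5))) :=
  TailSqueeze.tendsto_log_abs_lim_sub_div approxT 1 (θ := 1 / 50) (by norm_num) (by norm_num) hL
    abs_approxT_sub_succ_le (fun k hk => approxT_succ_ne k hk) tendsto_log_abs_approxT_sub_div

/-- **Exact decay of the forms**: if `ṽ_n/ũ_n → L` then `log|ũ_nL − ṽ_n|/n → −log ((1+√5)/2)⁵ = −2.40605912…`.
[cite: Zudilin2002CatalanRemarks, Sect. 2, Theorem 2] -/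
theorem tendsto_log_abs_formT_div_of_tendsto (hL : Tendsto approxT atTop (𝓝 L)) :
    Tendsto (fun n : ℕ => Real.log |uTR n * L - vTR n| / n) atTop
      (𝓝 (-Real.log (((1 + Real.sqrt 5) / 2) ^ 5))) := by
  have h := tendsto_log_uT_div.add (tendsto_log_abs_subT_div_of_tendsto hL)
  have e : Real.log (((1 + Real.sqrt 5) / 2) ^ 5) + -2 * Real.log (((1 + Real.sqrt 5) / 2) ^ 5) =
      -Real.log (((1 + Real.sqrt 5) / 2) ^ 5) := by ring
  rw [e] at h
  refine h.congr' ?_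
  filter_upwards [eventually_ge_atTop 1] with n hn
  have hu := uTR_pos n hn
  have hid : uTR n * L - vTR n = uTR n * (L - approxT n) := by
    unfold approxT; field_simp
  show Real.log ((uT n : ℚ) : ℝ) / n + Real.log |L - approxT n| / n = Real.log |uTR n * L - vTR n| / n
  by_cases h0 : L - approxT n = 0
  · exfalso; exact formT_ne_zero_of_tendsto hL n (by rw [hid, h0, mul_zero])
  · rw [hid, abs_mul, abs_of_pos hu, Real.log_mul hu.ne' (abs_ne_zero.2 h0), add_div]
    rfl

/-- **`|ũ_nL − ṽ_n|^{1/n} → ((√5−1)/2)⁵`** if `ṽ_n/ũ_n → L`. [cite: Zudilin2002CatalanRemarks, Sect. 2, Theorem 2] -/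
theorem tendsto_root_abs_formT_of_tendsto (hL : Tendsto approxT atTop (𝓝 L)) :
    Tendsto (fun n : ℕ => |uTR n * L - vTR n| ^ (1 / (n : ℝ))) atTop
      (𝓝 (((Real.sqrt 5 - 1) / 2) ^ 5)) := by
  have hl0 : (0 : ℝ) < ((1 + Real.sqrt 5) / 2) ^ 5 := by
    have := two_lt_sqrt_five; positivity
  have h1 := (Real.continuous_exp.tendsto _).comp (tendsto_log_abs_formT_div_of_tendsto hL)
  rw [Real.exp_neg, Real.exp_log hl0, ← golden_conj_fifth] at h1
  refine h1.congr' ?_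
  filter_upwards [eventually_ge_atTop 1] with n hn
  have hf := abs_pos.2 (formT_ne_zero_of_tendsto hL n)
  simp only [Function.comp]
  rw [Real.rpow_def_of_pos hf]
  congr 1
  ring

/-- **Summary for THE limit**: there is a real `L` with `ṽ_n/ũ_n → L`, `ũ_nL − ṽ_n ≠ 0` for every `n`, and
`|ũ_nL − ṽ_n|^{1/n} → ((√5−1)/2)⁵` — unconditionally. [cite: Zudilin2002CatalanRemarks, Sect. 2, Theorem 2] -/
theorem exists_limitT_rates :
    ∃ L : ℝ, Tendsto (fun n : ℕ => vTR n / uTR n) atTop (𝓝 L) ∧ (∀ n, uTR n * L - vTR n ≠ 0) ∧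
      Tendsto (fun n : ℕ => |uTR n * L - vTR n| ^ (1 / (n : ℝ))) atTop (𝓝 (((Real.sqrt 5 - 1) / 2) ^ 5)) := by
  obtain ⟨L, hL⟩ := exists_limitT
  exact ⟨L, hL, formT_ne_zero_of_tendsto hL, tendsto_root_abs_formT_of_tendsto hL⟩

/-! ### The decay conjunct (ii) of `remarksTheorem2`, granted the identification `ṽ_n/ũ_n → G` -/

/-- `ũ_nG − ṽ_n` is the tree's `formT n`. [cite: Zudilin2002CatalanRemarks, Sect. 2, eq. (12)] -/
theorem formT_eq (n : ℕ) : formT n = uTR n * catalanConstant - vTR n := rfl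

/-- **Non-vanishing of the forms, conditionally**: if `ṽ_n/ũ_n → G` then `ũ_nG − ṽ_n ≠ 0` for every `n`.
[cite: Zudilin2002CatalanRemarks, Sect. 2, Theorem 2] -/
theorem formT_ne_zero_of_tendsto_catalan
    (hG : Tendsto (fun n : ℕ => vTR n / uTR n) atTop (𝓝 catalanConstant)) (n : ℕ) : formT n ≠ 0 := by
  rw [formT_eq]; exact formT_ne_zero_of_tendsto hG n

/-- **The decay conjunct (ii) of `remarksTheorem2`, conditionally**: if `ṽ_n/ũ_n → G` then
`|ũ_nG − ṽ_n|^{1/n} → ((√5−1)/2)⁵ = exp(−2.40605912…)`. [cite: Zudilin2002CatalanRemarks, Sect. 2, Theorem 2] -/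
theorem remarksTheorem2_decay_of_tendsto
    (hG : Tendsto (fun n : ℕ => vTR n / uTR n) atTop (𝓝 catalanConstant)) :
    Tendsto (fun n : ℕ => |formT n| ^ (1 / (n : ℝ))) atTop (𝓝 (((Real.sqrt 5 - 1) / 2) ^ 5)) :=
  tendsto_root_abs_formT_of_tendsto hG

end Summit.KontsevichZagierPeriods.Zeta5Search.CatalanRemarksVT
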